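import Literature.MathematicalPhysics.QuantumFieldTheory.Balaban1983to89.B8SockSP5ProviderSrc
import Literature.MathematicalPhysics.QuantumFieldTheory.Balaban1983to89.B8SockHFPRDSrcGammaPrime

/-!
# `Balaban1983to89.B8SockSP5ProviderSrcGammaPrime` — [Balaban1985RegularSpaces] THE N05 KNIT's SOURCED SOCKET `SP5` AT ONE MEMBER, PROVIDED, EDITION γ′ — the
# socket text's (1.35) antecedent in print's literal p. 77 ONE-END-POINT class (the P-carrier's letter); twin of this seat's
# `B8SockSP5ProviderSrcGamma.sp5_of_sockLettersRD_src_γ` (p588763) on the γ′ body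

statement-level skeleton of published theorems with citation tags; proofs where landed; nothing here is a claim about the Yang–Mills mass gap

T. Bałaban, *Spaces of regular gauge field configurations on a lattice and gauge fixing conditions*, Commun. Math. Phys. **99** (1985) 75–102
`[Balaban1985RegularSpaces]` ("B8"; printed page = PDF page + 74): Prop. 5 (1.106)–(1.110) p. 94, Thm 4 p. 88 ∕ p. 95, (1.67)–(1.69) p. 88, (1.31) + (1.35) p. 82, p. 77, (1.5)–(1.6) p. 77, Prop. 3 p. 87, (1.61) p. 86, Thm 8 (1.146) p. 101;
[3] = [Balaban1985Averaging] Prop. 4 p. 36; [4] = [Balaban1985BackgroundPropagators] Thm 3.1 p. 397, (3.25) p. 394, Thm 3.3 p. 398.  PDF held: `paper:balaban1985-cmp99-regular-spaces-gauge-fixing`.  STATUS: published, refereed.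

CITATION HEADER (lean-in-tree rule).  Cell `pub-ymgap` (YM Track A, DAG node N05 = [B8], HUMAN RULING D-0062 ∕ D-0149 width seats), seat `pub-ymgap-dag-n05-w4` (g0):
W-SEAT-START-LIST v3 §n05 item 4 («the Prop-5 sockets, m ≥ 1 obligation»); INTENT-13…20 (cell bus 2026-08-28).  THE TWO γ-CURRENCIES OF (1.35) (cell bus 2026-08-28, dag-n05-d l.25492 ∕ this seat's ANSWER-CURRENCY).  The γ files of this seat state the datum's (1.35) as
«every level-`j` bond whose LOCALITY BOX lies in `Ω_{j−1}`» (the guard of dag-n05-e's driver `B8Thm4KLevelGamma`); the P-carrier of record (dag-n05-w1's `zdGF3P`,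
dag-n05-w2's (1.42) engine `B8Eq142KLevelLocalGammaPrime.H42_of_inAx_γ'`, dag-n05-d's D7-3∕D9 knits) states it in PRINT's LITERAL p. 77 class «every level-`j` bond with
at least one END-BLOCK `Bʲ(c±)` inside `Ω_j`» (γ′).  Under the collar law the γ antecedent is weaker, so a γ′-knit cannot feed a γ-socket; the γ′ providers are
therefore separate twins — THIS FILE and its `…GammaPrime` siblings — with (i) the (1.35) hypothesis∕antecedent in the one-end-point form, (ii) the tower law at the
relevant truncation displayed (what `H42_of_inAx_γ'` asks), (iii) the (1.42) step by `H42_of_inAx_γ'`; class law «box ⊂ Ω_{j−1}», windows `(L²α₀, L·α₂)` and the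
L²-scaled (1.56) constant as in edition γ.  Everything else byte-identical to the γ file.
★ `sp5_of_sockLettersRD_src_γ'` = `sp5_of_sockLettersRD_src_γ` with the CONCLUSION's (1.35) antecedent in the one-end-point form; body `sockHFP_body_of_join_RD_src_γ'`
(its `htwm` = the member law `htw` at truncation `m`); the knit's `SH59src` hypothesis taken with the SAME one-end-point (1.35) antecedent (dag-n05-d INTENT-10), fed directly; γ windows
family `hwinγ` as in edition γ; adapter `B8SockSP5OfLettersSrc.hP5_step_of_HFP_src` BY NAME.
Kind «kernel-checked proof», theorems only, no `def`, no existing module modified.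

HONEST SCOPE ∕ A6.  By-name re-assembly; 0 new estimates.  [4]'s letters and the sourced (1.59) lines ∕ b9 socket over the PARAMETRIC class `Λb` are HYPOTHESES
(false over a «box ⊂ Ω_j» class at nested members by dag-n05-c p572834 ∕ p576185, dag-n05-d p585094; = print's sourced (1.59) over `cubeLamBP'` ∕ `towerBondsP`,
open; N06 content at `m ≥ 1`); no joint-satisfiability claim; windows displayed, not discharged; `d ≥ 2`, `L ≥ 2`.  Count-neutral; N05 NOT discharged; no
count claim; one finite `𝕋⁴` programme at fixed `ε`, Bałaban as printed; the Yang–Mills mass gap (Clay) is NOT proved by any of this — R4 closes the conditional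
finite-`𝕋⁴` rung `BalabanLadder.UV` only; nothing continuum ∕ ℝ⁴ ∕ OS.  No `sorry`, no `def`, no `instance`, no `notation`.  Unit `pub-ymgap-dag-n05-w4` (g0), 2026-08-28.

RELATED IN THE TREE, NOT DUPLICATED: `B8SockSP5ProviderSrcGamma` (this seat; edition γ), `B8SockSP5ProviderSrc` (dag-n05-d), `B8SockHFPRDSrcGammaPrime` (this seat; USED), `B8SockP5uEProviderGamma` (this seat; `gammaWindows_of_guard`).
-/

noncomputable section

open NormedSpace

namespace Literature.MathematicalPhysics.QuantumFieldTheory.Balaban1983to89.B8SockSP5ProviderSrcGammaPrime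

open Complex (I)
open MatrixLog B7Prop1Explicit B7Prop2Explicit B7Prop1Local B7Eq92Concrete
open B7Prop2Explicit (C0 c2')
open B7Prop3Flat (c3)
open B7Prop10General (C6 C4G)
open B7Prop9Flat (C5')
open B7Eq78Linearization (conjR zdBlocking QprimeIter)
open B8Ineq132 (covDerivFwd covDeriv InAk)
open B8Eq119TwistedAxial (Restr129 InAx bgT)
open B8Eq184Proof (gaugeExp cfgExp)
open B8Eq182Proof (gAd)
open B8Eq188Proof (frakF3)
open B8Lemma1NonAbelian (mulCfg)
open B8Eq140Level (SideTouches)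
open B8Eq146AExpansion (iEta expCfg)
open B8Ineq130 (tlo thi)
open B8Thm2LogB (blockTop)
open B8Eq138LandauZd (InR138 covDivB covLap QT)
open B8Ineq125Concrete (C2p)
open B8Eq1117Concrete (XSpace)
open B8Eq155JBound (Jcur wsup wsup_nonneg)
open B7Prop4GeneralLevels (linCovIter)
open B8ScaledSupNorm (bondNorm msup Bdd msup_nonneg weight_mul_norm_le_msup weight_neg_natCast)
open B8Prop5ContractionKLevel (Bd2 Mc Kc)
open B8LambdaSpaceKLevel (wt)
open B8SockLettersRD (SockLettersRD)
open B8LanF146 (LanF146)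
open B8SockHFPRDSrc (sockHFP_body_of_join_RD_src)
open B8SockHFPRDSrcGammaPrime (sockHFP_body_of_join_RD_src_γ')
open B8SockSP5OfLettersSrc (hP5_step_of_HFP_src)
open QuantumLattice (blockSites)

-- `Site` alone could resolve to the torus sites of `Setup.lean`; re-export the `ℤ^d` sites of `B7Prop1Explicit`.
export B7Prop1Explicit (Site)

variable {d : ℕ} {𝔸 : Type*} [CStarAlgebra 𝔸] [Nontrivial 𝔸]
variable {L : ℕ} {η : ℝ} {k : ℕ} {Ω : ℕ → Set (Site d)} {Λs : ℕ → ℕ → Set (Site d)} {Λb : ℕ → ℕ → Set (Site d × Fin d)}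
  {B₀ B₀' B₀'H B₂' BG BR cL cP γ γ' B₈ : ℝ}

/-- ★ **THE SOURCED SOCKET `SP5` AT ONE MEMBER FROM [4]'s LETTERS, THE SOURCED b9 SOCKET AND A DISPLAYED WINDOWS FAMILY** (module docstring): the body of the N05 knit's
`SP5` binder (seat n05-c g5's text, source premiss ρ2) at `LanF := LanF146 L k η (Ω 0) Λs U₀ φ`, datum bound `5dLB₈(α₀ + α₁)`, output bound `8B₀′·5dLB₈·(α₀ + α₁)`.
[cite: Balaban1985RegularSpaces, Prop. 5 (1.106)–(1.110) p.94, Thm 4 p.88, Thm 8 (1.146) p.101; Balaban1985BackgroundPropagators, Thm 3.1 p.397, Thm 3.3 p.398] -/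
theorem sp5_of_sockLettersRD_src_γ' (hd2 : 2 ≤ d) (hL : 2 ≤ L) (hη : 0 < η) (hΩ : ∀ j, Ω (j + 1) ⊆ Ω j)
    -- PRINT's box law: the locality box of a datum bond of level `j` lies in `Ω_{j−1}` ((1.31); level 0: `Ω₀`)
    (hbox : ∀ m, m ≤ k → ∀ j, j ≤ m → ∀ c ∈ Λb m j, ∀ x, InBox (loK L j c.1) (bondHiK L j c.1 c.2) x → x ∈ Ω (j - 1))
    (hclass : ∀ m, m ≤ k → ∀ j, j ≤ m → ∀ c ∈ Λb m j,
      (c.1 ∈ Λs m j ∧ c.1 + e c.2 ∈ Λs m j) ∨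
      (∃ j', j = j' + 1 ∧ (∀ x, (L : ℤ) • c.1 ≤ x → x ≤ (L : ℤ) • c.1 + blockTop L → x ∈ Λs m j') ∧ c.1 + e c.2 ∈ Λs m j) ∨
      (∃ j', j = j' + 1 ∧ c.1 ∈ Λs m j ∧ (∀ x, (L : ℤ) • (c.1 + e c.2) ≤ x → x ≤ (L : ℤ) • (c.1 + e c.2) + blockTop L → x ∈ Λs m j')))
    (htw : ∀ m, m ≤ k → ∀ j, j ≤ m → ∀ y ∈ Λs m j, ∀ x, InBox (tlo L y j) (thi L y j) x → x ∈ Ω j)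
    (h8lt : ∀ m, m < k → ∀ j, j < m → Λs m j = Λs (m + 1) j)
    (h8top : ∀ m, m < k → ∀ x, x ∈ Λs m m ↔ x ∈ Λs (m + 1) m ∨ ∃ y ∈ Λs (m + 1) (m + 1), x ∈ blockSites L y)
    (hB₀ : 0 < B₀) (hB₀' : 0 < B₀') (hB₀'H : 0 < B₀'H) (hB₂' : 0 ≤ B₂') (hBG : 0 ≤ BG) (hBR : 0 ≤ BR) (hγ : 0 ≤ γ) (hγ' : 0 ≤ γ')
    (hB₀8 : B₀ ≤ B₈) (hγB : 2 * (γ' * B₀) ≤ 5 * (d : ℝ) * L * B₈)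
    (SLet : SockLettersRD (𝔸 := 𝔸) L BG BR B₀'H B₂' cL η k Ω Λs) (hcPL : cP ≤ cL)
    -- THE SOURCED b9 SOCKET AT THIS MEMBER (the knit's `SH59src` at `LanF := LanF146`)
    (SH59 : ∀ α₀ α₁ : ℝ, 0 < α₀ → 0 < α₁ → α₀ + α₁ ≤ cP →
      ∀ U₀ U' : Site d → Fin d → 𝔸ˣ, (∀ x κ, U₀ x κ ∈ unitaryUnits 𝔸) → (∀ x κ, U' x κ ∈ unitaryUnits 𝔸) →
      ∀ φ : Site d → 𝔸, ((InR138 L k η (Ω 0) (Λs k) U₀ φ ∧ (∀ x, IsSelfAdjoint (φ x)) ∧ (∀ x, x ∉ Ω 0 → φ x = 0) ∧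
          Bdd L k η (-(2 : ℝ)) (fun j (x : Site d) => x ∈ Ω j) φ) ∧
        msup L k η (-(2 : ℝ)) (fun j (x : Site d) => x ∈ Ω j) φ < γ * (α₀ + α₁)) →
      InAk L k η α₀ Ω U₀ → InAk L k η α₀ Ω (mulCfg U' U₀) → (∀ m, m ≤ k → InAx L m (Λs m) U₀ (mulCfg U' U₀)) →
      (∀ j, j ≤ k → ∀ (z : Site d) (μ : Fin d), 
        ((∀ x, InBox (tlo L z j) (thi L z j) x → x ∈ Ω j) ∨ (∀ x, InBox (tlo L (z + e μ) j) (thi L (z + e μ) j) x → x ∈ Ω j)) →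
        ‖(avgIter L (mulCfg U' U₀) j z μ : 𝔸) - (avgIter L U₀ j z μ : 𝔸)‖ ≤ α₁) →
      (∀ b ∈ {b : Site d × Fin d | SideTouches (Ω 0) b.1 b.2}, ‖((U' b.1 b.2 : 𝔸ˣ) : 𝔸) - 1‖ ≤ α₁) →
      (∀ m, 1 ≤ m → m ≤ k → ∀ (u : Site d → 𝔸ˣ) (W : Site d → Fin d → 𝔸ˣ) (A' : Site d → Fin d → 𝔸),
        (∀ x, u x ∈ unitaryUnits 𝔸) → mgauge U₀ u W = U' → Restr129 L m (Λs m) U₀ u → LanF146 L k η (Ω 0) Λs U₀ φ m W →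
        (∀ y τ, IsSelfAdjoint (A' y τ)) →
        (∀ j, j ≤ m → ∀ y τ, SideTouches (Ω j) y τ →
        W y τ = cfgExp η A' y τ ∧ ‖A' y τ‖ ≤ (2 * (L * (5 * (d : ℝ) * L * B₈ * (α₀ + α₁))) + 8 * (8 * B₀' * (5 * (d : ℝ) * L * B₈) * (α₀ + α₁))) * ((L : ℝ) ^ j * η)⁻¹) →
        (∀ y τ, (∀ j, j ≤ m → ¬ SideTouches (Ω j) y τ) → A' y τ = 0) →
        msup L m η (-(1 : ℝ)) (fun j (b : Site d × Fin d) => SideTouches (Ω j) b.1 b.2) (fun b => A' b.1 b.2)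
        ≤ B₀ * (bondNorm L m η (-(3 : ℝ)) Ω (fun x μ => Jcur η U₀ A' μ x)
        + wsup 1 (fun p : {p : ℕ × (Site d × Fin d) // p.1 ≤ m ∧ p.2 ∈ Λb m p.1} =>
        linCovIter L U₀ (iEta η A') p.1.1 p.1.2.1 p.1.2.2)) + γ' * B₀ * (α₀ + α₁) ∧
        msup L m η (-(2 : ℝ)) (fun j (t : Fin d × Fin d × Site d) => SideTouches (Ω j) t.2.2 t.2.1)
        (fun t => covDerivFwd η U₀ t.1 (fun z => A' z t.2.1) t.2.2)
        ≤ B₀ * (bondNorm L m η (-(3 : ℝ)) Ω (fun x μ => Jcur η U₀ A' μ x)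
        + wsup 1 (fun p : {p : ℕ × (Site d × Fin d) // p.1 ≤ m ∧ p.2 ∈ Λb m p.1} =>
        linCovIter L U₀ (iEta η A') p.1.1 p.1.2.1 p.1.2.2)) + γ' * B₀ * (α₀ + α₁)))
    -- the windows family (un-sourced `hfpWindows_of_guard` shape at `B₈`, smallness windows at `hE₂ + γ(α₀ + α₁)∕2`, the adapter's two windows)
    (hwin : ∀ α₀ α₁ : ℝ, 0 < α₀ → 0 < α₁ → α₀ + α₁ ≤ cP →
      ∀ cs α₄ cB cDA hE hE₂ lE lE₂ : ℝ, cs = 5 * (d : ℝ) * L * B₈ * (α₀ + α₁) → α₄ = 8 * B₀' * (5 * (d : ℝ) * L * B₈) * (α₀ + α₁) →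
      cB = L * cs → cDA = 2 * (d : ℝ) * (L : ℝ) ^ 2 * cs →
      hE = B₀'H * (C2p d * (40 * d * cB + α₄) * α₄) → hE₂ = B₂' * (C2p d * (40 * d * cB + α₄) * α₄) →
      lE = B₀'H * (4 * C2p d * (40 * d * cB + 2 * α₄)) → lE₂ = B₂' * (4 * C2p d * (40 * d * cB + 2 * α₄)) →
      36 * d * B₈ * cs ≤ 1 / 2 ∧
      8 * (131072 * ((d : ℝ) + 1) ^ 2) * Real.exp (4 * (800 * ((d : ℝ) + 1) ^ 2 * ((d : ℝ) + 4)) * α₀) ≤ 16 * (131072 * ((d : ℝ) + 1) ^ 2) ∧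
      2 * cs ^ 2 + 20 * d * α₀ * cs + 2 * (16 * (131072 * ((d : ℝ) + 1) ^ 2)) * cs ^ 2 ≤ α₀ + α₁ ∧
      (d : ℝ) * L * α₁ ≤ 1 / 8 ∧
      C0 d * α₀ ≤ 1 / 3 ∧ 4 * α₀ ≤ c2' d L ∧
      Real.exp (4 * (800 * ((d : ℝ) + 1) ^ 2 * ((d : ℝ) + 4)) * α₀) * (1 + 8 * (131072 * ((d : ℝ) + 1) ^ 2) * cB) ≤ 2 ∧
      2 * cB ≤ c3 d L ∧ 2048 * (d : ℝ) * cB ≤ 1 ∧ 40 * d * cB ≤ 1 / 200 ∧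
      200 * C6 d * (2 * α₄) ≤ 1 ∧ 12000 * ((d : ℝ) + 1) * L * (2 * α₄) ≤ 1 ∧
      C4G d L * (α₀ + 40 * d * cB + 4 * (2 * α₄)) ≤ 1 ∧
      1024 * ((d : ℝ) + 1) * ((d : ℝ) + 4) * L ^ 2 * α₀ ≤ 1 ∧ 32 * ((d : ℝ) + 1) ^ 2 * C6 d * L ^ 2 * α₀ ≤ 1 ∧
      16 * d * C5' d * C6 d * (L : ℝ) ^ 2 * α₀ ≤ 1 ∧ 8 * d * C6 d * L * α₀ ≤ 1 ∧
      40 * d * cB + α₄ ≤ 1 / (4 * B₀'H * (2 * C2p d)) ∧ 2 * C6 d * (40 * d * cB + 4 * α₄) ≤ 1 / 8 ∧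
      cB ≤ 1 / 13 ∧ α₄ / 4 + hE ≤ 1 / 24 ∧ α₄ / 4 + hE ≤ 1 / 140 ∧ 10 * (α₄ / 4 + hE) * BR ≤ 1 / 2 ∧
      BG * Mc d BR (α₄ / 4 + hE) cB (hE₂ + γ * (α₀ + α₁) / 2) cDA ≤ α₄ / 4 ∧
      BG * Kc d BR (α₄ / 4 + hE) cB (hE₂ + γ * (α₀ + α₁) / 2) cDA lE₂ (1 + lE) (1 + lE) ≤ 1 / 2 ∧
      α₄ ≤ 1 / 84 ∧ cs ≤ 1 / 12)
    -- (v) EDITION γ: the γ windows family below `c_P` (`B8SockP5uEProviderGamma.gammaWindows_of_guard` at `B₈`)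
    (hwinγ : ∀ α₀ α₁ : ℝ, 0 < α₀ → 0 < α₁ → α₀ + α₁ ≤ cP →
      ∀ cs cB : ℝ, cs = 5 * (d : ℝ) * L * B₈ * (α₀ + α₁) → cB = L * cs →
      C0 d * ((L : ℝ) ^ 2 * α₀) ≤ 1 / 3 ∧ 4 * ((L : ℝ) ^ 2 * α₀) ≤ c2' d L ∧
      Real.exp (4 * (800 * ((d : ℝ) + 1) ^ 2 * ((d : ℝ) + 4)) * ((L : ℝ) ^ 2 * α₀)) * (1 + 8 * (131072 * ((d : ℝ) + 1) ^ 2) * cB) ≤ 2 ∧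
      8 * (131072 * ((d : ℝ) + 1) ^ 2) * Real.exp (4 * (800 * ((d : ℝ) + 1) ^ 2 * ((d : ℝ) + 4)) * ((L : ℝ) ^ 2 * α₀)) * (L : ℝ) ^ 2
        ≤ 16 * (131072 * ((d : ℝ) + 1) ^ 2) * (L : ℝ) ^ 2 ∧
      2 * cs ^ 2 + 20 * d * α₀ * cs + 2 * (16 * (131072 * ((d : ℝ) + 1) ^ 2) * (L : ℝ) ^ 2) * cs ^ 2 ≤ α₀ + α₁) :
    -- THE ρ2 `SP5` BINDER BODY AT THIS MEMBER — EDITION γ ((1.35) antecedent in print's p. 77 guard «box ⊂ Ω (j − 1)», everything else byte-identical)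
    ∀ α₀ α₁ : ℝ, 0 < α₀ → 0 < α₁ → α₀ + α₁ ≤ cP →
      ∀ U₀ U' : Site d → Fin d → 𝔸ˣ, (∀ x κ, U₀ x κ ∈ unitaryUnits 𝔸) → (∀ x κ, U' x κ ∈ unitaryUnits 𝔸) →
      ∀ φ : Site d → 𝔸, ((InR138 L k η (Ω 0) (Λs k) U₀ φ ∧ (∀ x, IsSelfAdjoint (φ x)) ∧ (∀ x, x ∉ Ω 0 → φ x = 0) ∧
          Bdd L k η (-(2 : ℝ)) (fun j (x : Site d) => x ∈ Ω j) φ) ∧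
        msup L k η (-(2 : ℝ)) (fun j (x : Site d) => x ∈ Ω j) φ < γ * (α₀ + α₁)) →
      InAk L k η α₀ Ω U₀ → InAk L k η α₀ Ω (mulCfg U' U₀) → (∀ m, m ≤ k → InAx L m (Λs m) U₀ (mulCfg U' U₀)) →
      (∀ j, j ≤ k → ∀ (z : Site d) (μ : Fin d), 
        ((∀ x, InBox (tlo L z j) (thi L z j) x → x ∈ Ω j) ∨ (∀ x, InBox (tlo L (z + e μ) j) (thi L (z + e μ) j) x → x ∈ Ω j)) →
        ‖(avgIter L (mulCfg U' U₀) j z μ : 𝔸) - (avgIter L U₀ j z μ : 𝔸)‖ ≤ α₁) →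
      (∀ b ∈ {b : Site d × Fin d | SideTouches (Ω 0) b.1 b.2}, ‖((U' b.1 b.2 : 𝔸ˣ) : 𝔸) - 1‖ ≤ α₁) →
      (∀ m, 1 ≤ m → m < k → ∀ (u₁ : Site d → 𝔸ˣ) (U₁ : Site d → Fin d → 𝔸ˣ) (A : Site d → Fin d → 𝔸),
        (∀ x, u₁ x ∈ unitaryUnits 𝔸) → (∀ x, x ∉ Ω 0 → u₁ x = 1) → mgauge U₀ u₁ U₁ = U' → Restr129 L m (Λs m) U₀ u₁ →
        LanF146 L k η (Ω 0) Λs U₀ φ m U₁ →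
        (∀ j, j ≤ m → ∀ b ∈ {b : Site d × Fin d | SideTouches (Ω j) b.1 b.2},
        U₁ b.1 b.2 = cfgExp η A b.1 b.2 ∧ IsSelfAdjoint (A b.1 b.2) ∧ ‖A b.1 b.2‖ ≤ (5 * (d : ℝ) * L * B₈ * (α₀ + α₁)) * ((L : ℝ) ^ j * η)⁻¹) →
        ∃ (v : Site d → 𝔸ˣ) (lam : Site d → 𝔸), (∀ x, v x ∈ unitaryUnits 𝔸) ∧ (∀ x, x ∉ Ω 0 → v x = 1) ∧
        (∀ j, j ≤ m + 1 → ∀ b ∈ {b : Site d × Fin d | SideTouches (Ω j) b.1 b.2}, (v b.1 : 𝔸) = ((gaugeExp lam b.1 : 𝔸ˣ) : 𝔸) ∧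
        (v (b.1 + e b.2) : 𝔸) = ((gaugeExp lam (b.1 + e b.2) : 𝔸ˣ) : 𝔸)) ∧
        (∀ j, j ≤ m + 1 → ∀ b ∈ {b : Site d × Fin d | SideTouches (Ω j) b.1 b.2},
        ‖lam b.1‖ ≤ (8 * B₀' * (5 * (d : ℝ) * L * B₈) * (α₀ + α₁)) ∧ ((L : ℝ) ^ j * η) * ‖covDerivFwd η U₀ b.2 lam b.1‖ ≤ (8 * B₀' * (5 * (d : ℝ) * L * B₈) * (α₀ + α₁))) ∧
        LanF146 L k η (Ω 0) Λs U₀ φ (m + 1) (mgauge U₀ v⁻¹ U₁) ∧ Restr129 L (m + 1) (Λs (m + 1)) U₀ (u₁ * v)) := by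
  intro α₀ α₁ hα₀ hα₁ hs U₀ U' hU₀ hU' φ hφ h33 h34 hAx h135 h66 m hm1 hmk u₁ U₁ A hu₁ hu₁off hW h129 hLan hdat
  obtain ⟨⟨hInR, hφsa, hφoff, hBdd⟩, hφn⟩ := hφ
  have hL1 : 1 ≤ L := le_trans (by norm_num) hL
  have hLr : (1 : ℝ) ≤ L := by exact_mod_cast hL1
  have hsum : 0 < α₀ + α₁ := add_pos hα₀ hα₁
  have hB₈ : 0 < B₈ := lt_of_lt_of_le hB₀ hB₀8
  -- the windows at this (α₀, α₁)
  obtain ⟨hside, -, -, hsmall₁, hα3, hα4, hsmall, hc₃, hsc, hα₃', hs₁, hs₂, hs₃, hs₄, hs₅, hs₆, hs₇, hsm, hprod8, hcA', ha₁',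
    hb₁', hθ, h103, h106, hs84, hcs12⟩ := hwin α₀ α₁ hα₀ hα₁ hs _ _ _ _ _ _ _ _ rfl rfl rfl rfl rfl rfl rfl rfl
  -- the γ windows at this (α₀, α₁) (the (1.56)-constant line and (1.61) are the γ ones)
  obtain ⟨hα3L, hα4L, hsmallL, hC₂L, h61L⟩ := hwinγ α₀ α₁ hα₀ hα₁ hs _ _ rfl rfl
  -- EDITION γ′: the knit's `SH59src` binder carries the SAME one-end-point (1.35) antecedent (dag-n05-d INTENT-10), so `h135` feeds it directly
  -- the letters at the truncation `m + 1`
  have hα₀L : α₀ ≤ cL := by linarith only [hs, hcPL, hα₁]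
  obtain ⟨g, Δ, q, qs, Aw, c, H', g_rightΩ, c_range, hΔ, hqs, hq, hH0, hH1, hH2, hHsupp, hHequiv, hQH, hG, hGsupp, hGreal, hRbd, hRreal⟩ :=
    SLet α₀ hα₀ hα₀L U₀ hU₀ h33 (m + 1) (by omega) hmk
  have hcs0 : 0 ≤ 5 * (d : ℝ) * L * B₈ * (α₀ + α₁) := by positivity
  -- the source: size `γ(α₀ + α₁)` on the `Ω_j`, `j ≤ m + 1` (from the `Bdd` clause of ρ2 and the norm premiss), Hermitian
  have hmf : 0 ≤ γ * (α₀ + α₁) := by positivity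
  have hf : Bd2 L η (m + 1) Ω φ (γ * (α₀ + α₁)) := by
    intro j hj x hx
    have h := weight_mul_norm_le_msup hBdd (hj.trans (Nat.succ_le_of_lt hmk)) (i := x) hx
    have e2 : (-(2 : ℝ)) = -((2 : ℕ) : ℝ) := by norm_num
    rw [e2, weight_neg_natCast L η 2 j] at h
    have hw : wt L η j ^ 2 = ((L : ℝ) ^ j * η) ^ 2 := rfl
    rw [hw]
    rw [e2] at hφn
    exact h.trans hφn.le
  have hfsa : ∀ j, j ≤ m + 1 → ∀ x ∈ Ω j, IsSelfAdjoint (φ x) := fun _ _ x _ => hφsa x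
  -- the SOURCED b9 lines at the datum, from `SH59` at level `m` (monotonicity `B₀ ≤ B₈` on the non-negative bracket; `c⋆₈ ≤` the socket's constant)
  have hSg : 0 ≤ γ' * B₀ * (α₀ + α₁) := by positivity
  have SH59m : ∀ A' : Site d → Fin d → 𝔸, (∀ y τ, IsSelfAdjoint (A' y τ)) →
      (∀ j, j ≤ m → ∀ (y : Site d) (τ : Fin d), SideTouches (Ω j) y τ →
        U₁ y τ = cfgExp η A' y τ ∧ ‖A' y τ‖ ≤ (5 * (d : ℝ) * L * B₈ * (α₀ + α₁)) * ((L : ℝ) ^ j * η)⁻¹) →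
      (∀ (y : Site d) (τ : Fin d), (∀ j, j ≤ m → ¬ SideTouches (Ω j) y τ) → A' y τ = 0) →
      msup L m η (-(1 : ℝ)) (fun j (b : Site d × Fin d) => SideTouches (Ω j) b.1 b.2) (fun b => A' b.1 b.2)
          ≤ B₈ * (bondNorm L m η (-(3 : ℝ)) Ω (fun x μ => Jcur η U₀ A' μ x)
          + wsup 1 (fun p : {p : ℕ × (Site d × Fin d) // p.1 ≤ m ∧ p.2 ∈ Λb m p.1} =>
          linCovIter L U₀ (iEta η A') p.1.1 p.1.2.1 p.1.2.2)) + γ' * B₀ * (α₀ + α₁) ∧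
        msup L m η (-(2 : ℝ)) (fun j (t : Fin d × Fin d × Site d) => SideTouches (Ω j) t.2.2 t.2.1)
          (fun t => covDerivFwd η U₀ t.1 (fun z => A' z t.2.1) t.2.2)
          ≤ B₈ * (bondNorm L m η (-(3 : ℝ)) Ω (fun x μ => Jcur η U₀ A' μ x)
          + wsup 1 (fun p : {p : ℕ × (Site d × Fin d) // p.1 ≤ m ∧ p.2 ∈ Λb m p.1} =>
          linCovIter L U₀ (iEta η A') p.1.1 p.1.2.1 p.1.2.2)) + γ' * B₀ * (α₀ + α₁) := by
    intro A' hsa' hWA' hA0'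
    have hbig : ∀ j, j ≤ m → ∀ (y : Site d) (τ : Fin d), SideTouches (Ω j) y τ →
        U₁ y τ = cfgExp η A' y τ ∧ ‖A' y τ‖ ≤ (2 * (L * (5 * (d : ℝ) * L * B₈ * (α₀ + α₁))) +
          8 * (8 * B₀' * (5 * (d : ℝ) * L * B₈) * (α₀ + α₁))) * ((L : ℝ) ^ j * η)⁻¹ := by
      intro j hj y τ hsd
      obtain ⟨he, hb⟩ := hWA' j hj y τ hsd
      refine ⟨he, hb.trans (mul_le_mul_of_nonneg_right ?_ (by positivity))⟩
      have h1 : (1 : ℝ) * (5 * (d : ℝ) * L * B₈ * (α₀ + α₁)) ≤ L * (5 * (d : ℝ) * L * B₈ * (α₀ + α₁)) :=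
        mul_le_mul_of_nonneg_right hLr hcs0
      have h2 : 0 ≤ 8 * (8 * B₀' * (5 * (d : ℝ) * L * B₈) * (α₀ + α₁)) := by positivity
      linarith only [h1, h2, hcs0]
    obtain ⟨h1, h2⟩ := SH59 α₀ α₁ hα₀ hα₁ hs U₀ U' hU₀ hU' φ ⟨⟨hInR, hφsa, hφoff, hBdd⟩, hφn⟩ h33 h34 hAx h135 h66 m hm1 hmk.le u₁ U₁ A'
      hu₁ hW h129 hLan hsa' hbig hA0'
    have hX : 0 ≤ bondNorm L m η (-(3 : ℝ)) Ω (fun x μ => Jcur η U₀ A' μ x)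
        + wsup 1 (fun p : {p : ℕ × (Site d × Fin d) // p.1 ≤ m ∧ p.2 ∈ Λb m p.1} =>
          linCovIter L U₀ (iEta η A') p.1.1 p.1.2.1 p.1.2.2) := by
      have ha : 0 ≤ bondNorm L m η (-(3 : ℝ)) Ω (fun x μ => Jcur η U₀ A' μ x) := by
        unfold bondNorm; exact msup_nonneg L m hη.le _ _ _
      have hb := wsup_nonneg zero_le_one (fun p : {p : ℕ × (Site d × Fin d) // p.1 ≤ m ∧ p.2 ∈ Λb m p.1} =>
        linCovIter L U₀ (iEta η A') p.1.1 p.1.2.1 p.1.2.2)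
      linarith only [ha, hb]
    have hmono := mul_le_mul_of_nonneg_right hB₀8 hX
    exact ⟨h1.trans (by linarith only [hmono]), h2.trans (by linarith only [hmono])⟩
  -- `c_{DA} = 2dL²c⋆₈ ≥ dL²(c⋆₈ + 2Sg)` since `2γ′B₀ ≤ 5dLB₈`
  have hcDAlo : (d : ℝ) * (L : ℝ) ^ 2 * (5 * (d : ℝ) * L * B₈ * (α₀ + α₁) + 2 * (γ' * B₀ * (α₀ + α₁))) ≤
      2 * (d : ℝ) * (L : ℝ) ^ 2 * (5 * (d : ℝ) * L * B₈ * (α₀ + α₁)) := by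
    have h1 : 2 * (γ' * B₀ * (α₀ + α₁)) ≤ 5 * (d : ℝ) * L * B₈ * (α₀ + α₁) := by
      have h := mul_le_mul_of_nonneg_right hγB hsum.le
      linarith only [h]
    have h2 : (0 : ℝ) ≤ (d : ℝ) * (L : ℝ) ^ 2 := by positivity
    have h3 := mul_le_mul_of_nonneg_left h1 h2
    linarith only [h3]
  -- THE SOURCED BODY (`sockHFP_body_of_join_RD_src`) at `B₀ := B₈`, `Lan := LanF146 …`, `f := φ`
  have hbody := sockHFP_body_of_join_RD_src_γ' hd2 hL hη hΩ hbox hclass hm1 hmk (htw (m + 1) hmk) (htw m hmk.le) (h8lt m hmk) (h8top m hmk) hα₀ hα₁ hB₈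
    hB₀' rfl rfl
    hU₀ hU' h33 h34 hAx h135 hu₁ hW h129 (fun n W => LanF146 L k η (Ω 0) Λs U₀ φ n W) hLan hdat hSg SH59m hmf hf hfsa hside hC₂L h61L hsmall₁
    g Δ q qs Aw c g_rightΩ c_range hΔ hqs hq H' hB₀'H hB₂' hBG hBR hH0 hH1 hH2 hHsupp hHequiv hQH hG hGsupp hGreal hRbd hRreal le_rfl le_rfl
    hcDAlo hα3 hα4 hα3L hα4L hsmallL hsmall hc₃ hsc hα₃' hs₁ hs₂ hs₃ hs₄ hs₅ hs₆ hs₇ hsm hprod8 rfl rfl rfl rfl hcA' ha₁' hb₁' hθ h103 h106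
  -- THE SOURCED ADAPTER: `v := e^{iλ}`, (1.108), `LanF146` at `m + 1` for `U₁^{v⁻¹}`, (1.29)
  exact hP5_step_of_HFP_src hd2 hη L k m hU₀ hs84 hcs12 Ω Λs u₁ U₁ A φ hInR hdat hbody

#print axioms sp5_of_sockLettersRD_src_γ'

end Literature.MathematicalPhysics.QuantumFieldTheory.Balaban1983to89.B8SockSP5ProviderSrcGammaPrime

end
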